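import Literature.Claims.NS.Tsionskiy2025
import Summits.NavierStokesRegularity.NavierStokesRegularity.Theorems.SoloRefuteTsionskiy2025Step3
import Literature.Analysis.FunctionSpaces.GaussianSchwartz
import Literature.Analysis.FunctionSpaces.BochnerProofs
import Mathlib.Analysis.Complex.ExponentialBounds

/-!
# C15 `Tsionskiy2025` — refutation toolkit, part 1/3: Gaussian averages of the cutoff `δ`

Cell `ns-claims` (D-0090 NS-CLAIMS SWEEP), claim C15; refuter `ns-claims-refuter-6`. Text of record:
A. Tsionskiy, M. Tsionskiy, Int. J. Math. Anal. 19 (2025) no. 3, 117–149 [TsionskiyTsionskiy2025]; typed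
skeleton `Literature.Claims.NS.Tsionskiy2025` (its `cutoff` = the paper's `δ(γ) = exp(−ε³/|γ|²)`,
(3.11)–(3.12) p. 122, is used verbatim).

Pure real analysis, no operators yet: pointwise exponential-Chebyshev splits of `δ` and `1 − δ`
(`cutoff_le_split`, `one_sub_cutoff_le_split`), the unit-mass Fourier-side Gaussian
`Ĝ_a(ξ) = (π/a)^{3/2} e^{−π²|ξ|²/a}` (`ghat`), and the three averaged bounds every countermodel of parts
2/3 rests on — `avg_cutoff_le` (`∫ δ(2πξ) Ĝ_a ≤ e^{−ε³/r²} + 8e^{−3r²/(16a)}`), `avg_heat_eq`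
(`∫ e^{−s|2πξ|²} Ĝ_q = (1+4sq)^{−3/2}`), `avg_multB_ge` (lower bound for the `B`-multiplier average) —
all reduced to `∫_{ℝ³} e^{−b|v|²} dv = (π/b)^{3/2}`; plus the numeric constants `e^{−3} + 8e^{−9} ≤ 1/10`,
`(e^{−3})² ≤ 1/400` (`exp_neg_three_bounds`). The refutations (`not_Step_2`, `not_Step_3`) are in parts 2/3
(`SoloRefuteTsionskiy2025.lean`, `SoloRefuteTsionskiy2025OpE.lean`).

WHAT THIS IS NOT: not a claim about NS regularity or blow-up; not a claim about any author beyond the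
typed locator.
-/

-- The summit's canonical theorem namespace repeats the summit name (single-conjunct summit).
set_option linter.dupNamespace false

noncomputable section

open MeasureTheory Real
open scoped RealInnerProductSpace FourierTransform ContDiff SchwartzMap
open Literature.Claims.NS.Tsionskiy2025

namespace Summit.NavierStokesRegularity.NavierStokesRegularity.Theorems.Tsionskiy2025

/-- `ℝ³`. -/
abbrev E3 := EuclideanSpace ℝ (Fin 3)

/-- `dim ℝ³ = 3`. -/
lemma finrank_E3 : Module.finrank ℝ E3 = 3 := finrank_euclideanSpace_fin

/-- `∫_{ℝ³} e^{-b‖v‖²} dv = (π/b)^{3/2}`. -/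
lemma integral_gauss {b : ℝ} (hb : 0 < b) :
    ∫ v : E3, Real.exp (-b * ‖v‖ ^ 2) = (π / b) ^ ((3:ℝ) / 2) := by
  rw [GaussianFourier.integral_rexp_neg_mul_sq_norm hb, finrank_E3]
  norm_num

/-- The Gaussian `e^{-b‖v‖²}`, `b > 0`, is integrable on `ℝ³`. -/
lemma integrable_gauss {b : ℝ} (hb : 0 < b) :
    Integrable (fun v : E3 => Real.exp (-b * ‖v‖ ^ 2)) :=
  Literature.Analysis.FunctionSpaces.integrable_rexp_neg_mul_sq_norm hb

/-! ## The cutoff `δ` of (3.11) p.122 and its pointwise bounds -/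

-- `cutoff ε γ = if γ = 0 then 0 else exp(-ε³/‖γ‖²)` is the skeleton's `Literature.Claims.NS.Tsionskiy2025.cutoff`.

/-- `0 ≤ δ(γ)` ((3.11)–(3.12) p. 122). -/
lemma cutoff_nonneg (ε : ℝ) (γ : E3) : 0 ≤ cutoff ε γ := by
  unfold cutoff; split_ifs
  · exact le_rfl
  · exact (Real.exp_pos _).le

/-- `δ(γ) ≤ 1` for `ε ≥ 0`. -/
lemma cutoff_le_one {ε : ℝ} (hε : 0 ≤ ε) (γ : E3) : cutoff ε γ ≤ 1 := by
  unfold cutoff; split_ifs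
  · exact zero_le_one
  · rw [Real.exp_le_one_iff, neg_div]
    exact neg_nonpos.mpr (by positivity)

/-- Low frequencies: for `‖γ‖ ≤ r` the cutoff is at most `exp(-ε³/r²)`. -/
lemma cutoff_le_of_norm_le {ε r : ℝ} (hε : 0 ≤ ε) (_hr : 0 < r) {γ : E3} (hγ : ‖γ‖ ≤ r) :
    cutoff ε γ ≤ Real.exp (-(ε ^ 3) / r ^ 2) := by
  unfold cutoff; split_ifs with h
  · exact (Real.exp_pos _).le
  · have hγ0 : 0 < ‖γ‖ := norm_pos_iff.mpr h
    rw [Real.exp_le_exp, neg_div, neg_div, neg_le_neg_iff]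
    exact div_le_div_of_nonneg_left (by positivity) (by positivity)
      (pow_le_pow_left₀ hγ0.le hγ 2)

/-- High frequencies: for `r ≤ ‖γ‖`, `0 < r`, the cutoff is at least `exp(-ε³/r²)`. -/
lemma le_cutoff_of_le_norm {ε r : ℝ} (hε : 0 ≤ ε) (hr : 0 < r) {γ : E3} (hγ : r ≤ ‖γ‖) :
    Real.exp (-(ε ^ 3) / r ^ 2) ≤ cutoff ε γ := by
  have hγ0 : 0 < ‖γ‖ := hr.trans_le hγ
  have hne : γ ≠ 0 := norm_pos_iff.mp hγ0
  unfold cutoff; rw [if_neg hne]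
  rw [Real.exp_le_exp, neg_div, neg_div, neg_le_neg_iff]
  exact div_le_div_of_nonneg_left (by positivity) (by positivity) (pow_le_pow_left₀ hr.le hγ 2)

/-- (P1) `δ(γ) ≤ exp(-ε³/r²) + exp(κ(‖γ‖² - r²))` for all `γ` (`κ, r > 0`). -/
lemma cutoff_le_split {ε r κ : ℝ} (hε : 0 ≤ ε) (hr : 0 < r) (hκ : 0 ≤ κ) (γ : E3) :
    cutoff ε γ ≤ Real.exp (-(ε ^ 3) / r ^ 2) + Real.exp (κ * (‖γ‖ ^ 2 - r ^ 2)) := by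
  rcases le_or_gt ‖γ‖ r with h | h
  · exact (cutoff_le_of_norm_le hε hr h).trans (le_add_of_nonneg_right (Real.exp_pos _).le)
  · have h1 : cutoff ε γ ≤ 1 := cutoff_le_one hε γ
    have h2 : (1:ℝ) ≤ Real.exp (κ * (‖γ‖ ^ 2 - r ^ 2)) := by
      rw [Real.one_le_exp_iff]
      exact mul_nonneg hκ (by nlinarith [norm_nonneg γ])
    linarith [(Real.exp_pos (-(ε ^ 3) / r ^ 2)).le]

/-- (P2) `1 - δ(γ) ≤ (1 - exp(-ε³/r₀²)) + exp(κ(r₀² - ‖γ‖²))` for all `γ` (`κ ≥ 0, r₀ > 0`). -/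
lemma one_sub_cutoff_le_split {ε r₀ κ : ℝ} (hε : 0 ≤ ε) (hr : 0 < r₀) (hκ : 0 ≤ κ) (γ : E3) :
    1 - cutoff ε γ ≤ (1 - Real.exp (-(ε ^ 3) / r₀ ^ 2)) + Real.exp (κ * (r₀ ^ 2 - ‖γ‖ ^ 2)) := by
  rcases lt_or_ge ‖γ‖ r₀ with h | h
  · have h1 : 0 ≤ cutoff ε γ := cutoff_nonneg ε γ
    have h2 : (1:ℝ) ≤ Real.exp (κ * (r₀ ^ 2 - ‖γ‖ ^ 2)) := by
      rw [Real.one_le_exp_iff]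
      exact mul_nonneg hκ (by nlinarith [norm_nonneg γ])
    have h3 : Real.exp (-(ε ^ 3) / r₀ ^ 2) ≤ 1 := by
      rw [Real.exp_le_one_iff, neg_div]; exact neg_nonpos.mpr (by positivity)
    linarith
  · have := le_cutoff_of_le_norm hε hr h
    linarith [(Real.exp_pos (κ * (r₀ ^ 2 - ‖γ‖ ^ 2))).le]

/-! ## The Fourier-side Gaussian `Ĝ_a(ξ) = (π/a)^{3/2} e^{-π²‖ξ‖²/a}` (unit mass) -/

/-- `Ĝ_a`, the Fourier transform (Mathlib normalisation) of `x ↦ e^{-a‖x‖²}`. -/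
def ghat (a : ℝ) (ξ : E3) : ℝ := (π / a) ^ ((3:ℝ) / 2) * Real.exp (-(π ^ 2 / a) * ‖ξ‖ ^ 2)

/-- `Ĝ_a ≥ 0`. -/
lemma ghat_nonneg {a : ℝ} (ha : 0 < a) (ξ : E3) : 0 ≤ ghat a ξ := by
  unfold ghat; positivity

/-- `Ĝ_a` is integrable (`a > 0`). -/
lemma integrable_ghat {a : ℝ} (ha : 0 < a) : Integrable (ghat a) :=
  (integrable_gauss (b := π ^ 2 / a) (by positivity)).const_mul _

/-- `∫ Ĝ_a = 1` (`a > 0`): unit mass. -/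
lemma integral_ghat {a : ℝ} (ha : 0 < a) : ∫ ξ : E3, ghat a ξ = 1 := by
  unfold ghat
  rw [integral_const_mul, integral_gauss (by positivity)]
  rw [← Real.mul_rpow (by positivity) (by positivity)]
  have : π / a * (π / (π ^ 2 / a)) = 1 := by field_simp
  rw [this, Real.one_rpow]

/-- Gaussian average of `exp(c‖ξ‖²)` against `Ĝ_a` for `c < π²/a`:
`∫ exp(c‖ξ‖²) Ĝ_a(ξ) dξ = (π²/(π² - a c))^{3/2}`... stated in the form we use:
`= (π/a)^{3/2} (π/(π²/a - c))^{3/2}`. -/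
lemma integral_exp_mul_ghat {a c : ℝ} (hc : c < π ^ 2 / a) :
    ∫ ξ : E3, Real.exp (c * ‖ξ‖ ^ 2) * ghat a ξ
      = (π / a) ^ ((3:ℝ) / 2) * (π / (π ^ 2 / a - c)) ^ ((3:ℝ) / 2) := by
  have hb : 0 < π ^ 2 / a - c := sub_pos.mpr hc
  have : ∀ ξ : E3, Real.exp (c * ‖ξ‖ ^ 2) * ghat a ξ
      = (π / a) ^ ((3:ℝ) / 2) * Real.exp (-(π ^ 2 / a - c) * ‖ξ‖ ^ 2) := by
    intro ξ; unfold ghat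
    rw [mul_left_comm, ← Real.exp_add]
    congr 2; ring
  simp_rw [this]
  rw [integral_const_mul, integral_gauss hb]

/-- `e^{c‖ξ‖²} Ĝ_a(ξ)` is integrable for `c < π²/a`. -/
lemma integrable_exp_mul_ghat {a c : ℝ} (hc : c < π ^ 2 / a) :
    Integrable (fun ξ : E3 => Real.exp (c * ‖ξ‖ ^ 2) * ghat a ξ) := by
  have hb : 0 < π ^ 2 / a - c := sub_pos.mpr hc
  have : ∀ ξ : E3, Real.exp (c * ‖ξ‖ ^ 2) * ghat a ξ
      = (π / a) ^ ((3:ℝ) / 2) * Real.exp (-(π ^ 2 / a - c) * ‖ξ‖ ^ 2) := by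
    intro ξ; unfold ghat
    rw [mul_left_comm, ← Real.exp_add]
    congr 2; ring
  simp_rw [this]
  exact (integrable_gauss hb).const_mul _

/-! ## Averaged bounds -/

/-- `ξ ↦ δ(2πξ)` is measurable. -/
lemma measurable_cutoff_smul (ε : ℝ) : Measurable (fun ξ : E3 => cutoff ε ((2 * π) • ξ)) :=
  (measurable_cutoff ε).comp (measurable_id.const_smul (2 * π))

/-- `‖2πξ‖² = 4π²‖ξ‖²`. -/
lemma norm_two_pi_smul_sq (ξ : E3) : ‖(2 * π) • ξ‖ ^ 2 = 4 * π ^ 2 * ‖ξ‖ ^ 2 := by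
  rw [norm_smul, Real.norm_eq_abs, abs_of_pos (by positivity), mul_pow]; ring

/-- `δ(2πξ) Ĝ_a(ξ)` is integrable. -/
lemma integrable_cutoff_smul_mul_ghat {ε a : ℝ} (hε : 0 ≤ ε) (ha : 0 < a) :
    Integrable (fun ξ : E3 => cutoff ε ((2 * π) • ξ) * ghat a ξ) := by
  refine (integrable_ghat ha).bdd_mul (c := 1) (measurable_cutoff_smul ε).aestronglyMeasurable ?_
  exact ae_of_all _ fun ξ => by
    rw [Real.norm_eq_abs, abs_of_nonneg (cutoff_nonneg _ _)]; exact cutoff_le_one hε _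

/-- (A4) The wide-Gaussian average of the cutoff is small:
`∫ δ(2πξ) Ĝ_a(ξ) dξ ≤ e^{-ε³/r²} + 8 e^{-3r²/(16a)}` for all `r > 0`. -/
lemma avg_cutoff_le {ε a r : ℝ} (hε : 0 < ε) (ha : 0 < a) (hr : 0 < r) :
    ∫ ξ : E3, cutoff ε ((2 * π) • ξ) * ghat a ξ
      ≤ Real.exp (-(ε ^ 3) / r ^ 2) + 8 * Real.exp (-(3 * r ^ 2) / (16 * a)) := by
  set κ : ℝ := 3 / (16 * a) with hκ
  have hκ0 : 0 ≤ κ := by positivity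
  have hc : 4 * π ^ 2 * κ < π ^ 2 / a := by
    have : π ^ 2 / a - 4 * π ^ 2 * κ = π ^ 2 / (4 * a) := by rw [hκ]; field_simp; ring
    have h4 : 0 < π ^ 2 / (4 * a) := by positivity
    linarith
  have hpt : ∀ ξ : E3, cutoff ε ((2 * π) • ξ) * ghat a ξ
      ≤ (Real.exp (-(ε ^ 3) / r ^ 2)
          + Real.exp (-(κ * r ^ 2)) * Real.exp ((4 * π ^ 2 * κ) * ‖ξ‖ ^ 2)) * ghat a ξ := by
    intro ξ
    refine mul_le_mul_of_nonneg_right ?_ (ghat_nonneg ha ξ)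
    have h := cutoff_le_split hε.le hr hκ0 ((2 * π) • ξ)
    rw [norm_two_pi_smul_sq] at h
    refine h.trans (le_of_eq ?_)
    rw [← Real.exp_add]; congr 2; ring
  have h1 := (integrable_ghat ha).const_mul (Real.exp (-(ε ^ 3) / r ^ 2))
  have h2 := (integrable_exp_mul_ghat hc).const_mul (Real.exp (-(κ * r ^ 2)))
  have hsplit : (fun ξ : E3 => (Real.exp (-(ε ^ 3) / r ^ 2)
          + Real.exp (-(κ * r ^ 2)) * Real.exp ((4 * π ^ 2 * κ) * ‖ξ‖ ^ 2)) * ghat a ξ)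
      = (fun ξ => Real.exp (-(ε ^ 3) / r ^ 2) * ghat a ξ
          + Real.exp (-(κ * r ^ 2)) * (Real.exp ((4 * π ^ 2 * κ) * ‖ξ‖ ^ 2) * ghat a ξ)) :=
    funext fun ξ => by ring
  have h8 : (π / a) ^ ((3:ℝ) / 2) * (π / (π ^ 2 / a - 4 * π ^ 2 * κ)) ^ ((3:ℝ) / 2) = 8 := by
    rw [← Real.mul_rpow (by positivity) (div_nonneg Real.pi_pos.le (sub_pos.mpr hc).le)]
    have : π / a * (π / (π ^ 2 / a - 4 * π ^ 2 * κ)) = 4 := by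
      rw [hκ]; field_simp; ring
    rw [this, show (4:ℝ) = 2 ^ (2:ℝ) by norm_num, ← Real.rpow_mul (by norm_num)]
    norm_num
  calc ∫ ξ : E3, cutoff ε ((2 * π) • ξ) * ghat a ξ
      ≤ ∫ ξ : E3, (Real.exp (-(ε ^ 3) / r ^ 2)
          + Real.exp (-(κ * r ^ 2)) * Real.exp ((4 * π ^ 2 * κ) * ‖ξ‖ ^ 2)) * ghat a ξ := by
        refine integral_mono (integrable_cutoff_smul_mul_ghat hε.le ha) ?_ hpt
        rw [hsplit]; exact h1.add h2
    _ = Real.exp (-(ε ^ 3) / r ^ 2) + Real.exp (-(κ * r ^ 2)) * 8 := by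
        rw [hsplit, integral_add h1 h2, integral_const_mul, integral_const_mul, integral_ghat ha,
          mul_one, integral_exp_mul_ghat hc, h8]
    _ = Real.exp (-(ε ^ 3) / r ^ 2) + 8 * Real.exp (-(3 * r ^ 2) / (16 * a)) := by
        have : -(κ * r ^ 2) = -(3 * r ^ 2) / (16 * a) := by rw [hκ]; ring
        rw [this, mul_comm]

/-- Pointwise: `e^{-s‖γ‖²} δ(γ) ≥ e^{-s‖γ‖²} - (1 - δ(γ))`. -/
lemma heat_mul_cutoff_ge {ε s : ℝ} (hε : 0 ≤ ε) (hs : 0 ≤ s) (γ : E3) :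
    Real.exp (-s * ‖γ‖ ^ 2) - (1 - cutoff ε γ) ≤ Real.exp (-s * ‖γ‖ ^ 2) * cutoff ε γ := by
  have h1 : Real.exp (-s * ‖γ‖ ^ 2) ≤ 1 := by
    rw [Real.exp_le_one_iff]; nlinarith [norm_nonneg γ]
  have h2 : 0 ≤ 1 - cutoff ε γ := sub_nonneg.mpr (cutoff_le_one hε γ)
  nlinarith [(Real.exp_pos (-s * ‖γ‖ ^ 2)).le, cutoff_nonneg ε γ]

/-- `ξ ↦ e^{-s‖2πξ‖²} δ(2πξ)` is measurable. -/
lemma measurable_heat_mul_cutoff_smul (ε s : ℝ) :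
    Measurable (fun ξ : E3 => Real.exp (-s * ‖(2 * π) • ξ‖ ^ 2) * cutoff ε ((2 * π) • ξ)) :=
  ((Real.measurable_exp.comp (measurable_const.mul ((measurable_id.const_smul (2 * π)).norm.pow_const 2))).mul
    (measurable_cutoff_smul ε))

/-- `e^{-s‖2πξ‖²} δ(2πξ) Ĝ_q(ξ)` is integrable (`s ≥ 0`). -/
lemma integrable_heat_mul_cutoff_smul_mul_ghat {ε s q : ℝ} (hε : 0 ≤ ε) (hs : 0 ≤ s) (hq : 0 < q) :
    Integrable (fun ξ : E3 => (Real.exp (-s * ‖(2 * π) • ξ‖ ^ 2) * cutoff ε ((2 * π) • ξ)) * ghat q ξ) := by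
  refine (integrable_ghat hq).bdd_mul (c := 1) (measurable_heat_mul_cutoff_smul ε s).aestronglyMeasurable ?_
  refine ae_of_all _ fun ξ => ?_
  have h1 : Real.exp (-s * ‖(2 * π) • ξ‖ ^ 2) ≤ 1 := by
    rw [Real.exp_le_one_iff]; nlinarith [norm_nonneg ((2 * π) • ξ)]
  rw [Real.norm_eq_abs, abs_of_nonneg (mul_nonneg (Real.exp_pos _).le (cutoff_nonneg _ _))]
  exact mul_le_one₀ h1 (cutoff_nonneg _ _) (cutoff_le_one hε _)

/-- (A5a) The exact heat average: `∫ e^{-s‖2πξ‖²} Ĝ_q(ξ) dξ = (1/(1 + 4 s q))^{3/2}`. -/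
lemma avg_heat_eq {s q : ℝ} (hs : 0 ≤ s) (hq : 0 < q) :
    ∫ ξ : E3, Real.exp (-s * ‖(2 * π) • ξ‖ ^ 2) * ghat q ξ = (1 / (1 + 4 * s * q)) ^ ((3:ℝ) / 2) := by
  have hc : -(4 * π ^ 2 * s) < π ^ 2 / q := by
    have : 0 < π ^ 2 / q := by positivity
    nlinarith [Real.pi_pos]
  have hfun : (fun ξ : E3 => Real.exp (-s * ‖(2 * π) • ξ‖ ^ 2) * ghat q ξ)
      = fun ξ => Real.exp (-(4 * π ^ 2 * s) * ‖ξ‖ ^ 2) * ghat q ξ := by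
    funext ξ; rw [norm_two_pi_smul_sq]; congr 2; ring
  rw [hfun, integral_exp_mul_ghat hc, ← Real.mul_rpow (by positivity)
    (div_nonneg Real.pi_pos.le (sub_pos.mpr hc).le)]
  congr 1
  rw [sub_neg_eq_add, div_mul_div_comm, div_eq_div_iff (by positivity) (by positivity)]
  field_simp

/-- (A5b) The narrow-Gaussian average of `1 - δ` is small:
`∫ (1 - δ(2πξ)) Ĝ_q(ξ) dξ ≤ (1 - e^{-ε³/r₀²}) + e^{κ r₀²} (1/(1 + 4 κ q))^{3/2}` (`κ ≥ 0, r₀ > 0`). -/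
lemma avg_one_sub_cutoff_le {ε q r₀ κ : ℝ} (hε : 0 < ε) (hq : 0 < q) (hr : 0 < r₀) (hκ : 0 ≤ κ) :
    ∫ ξ : E3, (1 - cutoff ε ((2 * π) • ξ)) * ghat q ξ
      ≤ (1 - Real.exp (-(ε ^ 3) / r₀ ^ 2))
        + Real.exp (κ * r₀ ^ 2) * (1 / (1 + 4 * κ * q)) ^ ((3:ℝ) / 2) := by
  have hc : -(4 * π ^ 2 * κ) < π ^ 2 / q := by
    have : 0 < π ^ 2 / q := by positivity
    nlinarith [Real.pi_pos]
  have hpt : ∀ ξ : E3, (1 - cutoff ε ((2 * π) • ξ)) * ghat q ξ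
      ≤ ((1 - Real.exp (-(ε ^ 3) / r₀ ^ 2))
          + Real.exp (κ * r₀ ^ 2) * Real.exp (-(4 * π ^ 2 * κ) * ‖ξ‖ ^ 2)) * ghat q ξ := by
    intro ξ
    refine mul_le_mul_of_nonneg_right ?_ (ghat_nonneg hq ξ)
    have h := one_sub_cutoff_le_split hε.le hr hκ ((2 * π) • ξ)
    rw [norm_two_pi_smul_sq] at h
    refine h.trans (le_of_eq ?_)
    rw [← Real.exp_add]; congr 2; ring
  have hint : Integrable (fun ξ : E3 => (1 - cutoff ε ((2 * π) • ξ)) * ghat q ξ) := by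
    have := (integrable_ghat hq).sub (integrable_cutoff_smul_mul_ghat hε.le hq)
    convert this using 1; funext ξ; simp only [Pi.sub_apply]; ring
  have h1 := (integrable_ghat hq).const_mul (1 - Real.exp (-(ε ^ 3) / r₀ ^ 2))
  have h2 := (integrable_exp_mul_ghat hc).const_mul (Real.exp (κ * r₀ ^ 2))
  have hsplit : (fun ξ : E3 => ((1 - Real.exp (-(ε ^ 3) / r₀ ^ 2))
          + Real.exp (κ * r₀ ^ 2) * Real.exp (-(4 * π ^ 2 * κ) * ‖ξ‖ ^ 2)) * ghat q ξ)
      = (fun ξ => (1 - Real.exp (-(ε ^ 3) / r₀ ^ 2)) * ghat q ξ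
          + Real.exp (κ * r₀ ^ 2) * (Real.exp (-(4 * π ^ 2 * κ) * ‖ξ‖ ^ 2) * ghat q ξ)) :=
    funext fun ξ => by ring
  have hval : (π / q) ^ ((3:ℝ) / 2) * (π / (π ^ 2 / q - -(4 * π ^ 2 * κ))) ^ ((3:ℝ) / 2)
      = (1 / (1 + 4 * κ * q)) ^ ((3:ℝ) / 2) := by
    rw [← Real.mul_rpow (by positivity) (div_nonneg Real.pi_pos.le (sub_pos.mpr hc).le)]
    congr 1
    rw [sub_neg_eq_add, div_mul_div_comm, div_eq_div_iff (by positivity) (by positivity)]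
    field_simp
  calc ∫ ξ : E3, (1 - cutoff ε ((2 * π) • ξ)) * ghat q ξ
      ≤ ∫ ξ : E3, ((1 - Real.exp (-(ε ^ 3) / r₀ ^ 2))
          + Real.exp (κ * r₀ ^ 2) * Real.exp (-(4 * π ^ 2 * κ) * ‖ξ‖ ^ 2)) * ghat q ξ := by
        refine integral_mono hint ?_ hpt
        rw [hsplit]; exact h1.add h2
    _ = (1 - Real.exp (-(ε ^ 3) / r₀ ^ 2))
        + Real.exp (κ * r₀ ^ 2) * (1 / (1 + 4 * κ * q)) ^ ((3:ℝ) / 2) := by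
        rw [hsplit, integral_add h1 h2, integral_const_mul, integral_const_mul, integral_ghat hq,
          mul_one, integral_exp_mul_ghat hc, hval]

/-- (A5) Lower bound for the narrow-Gaussian average of the `B`-multiplier
`m_B(γ) = e^{-s‖γ‖²} δ(γ)` (`s = ν t`):
`∫ m_B(2πξ) Ĝ_q(ξ) dξ ≥ (1/(1+4sq))^{3/2} - (1 - e^{-ε³/r₀²}) - e^{κ r₀²}(1/(1+4κq))^{3/2}`. -/
lemma avg_multB_ge {ε s q r₀ κ : ℝ} (hε : 0 < ε) (hs : 0 ≤ s) (hq : 0 < q) (hr : 0 < r₀) (hκ : 0 ≤ κ) :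
    (1 / (1 + 4 * s * q)) ^ ((3:ℝ) / 2) - (1 - Real.exp (-(ε ^ 3) / r₀ ^ 2))
        - Real.exp (κ * r₀ ^ 2) * (1 / (1 + 4 * κ * q)) ^ ((3:ℝ) / 2)
      ≤ ∫ ξ : E3, (Real.exp (-s * ‖(2 * π) • ξ‖ ^ 2) * cutoff ε ((2 * π) • ξ)) * ghat q ξ := by
  have hA := avg_heat_eq hs hq
  have hB := avg_one_sub_cutoff_le hε hq hr hκ
  have hintA : Integrable (fun ξ : E3 => Real.exp (-s * ‖(2 * π) • ξ‖ ^ 2) * ghat q ξ) := by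
    have hc : -(4 * π ^ 2 * s) < π ^ 2 / q := by
      have : 0 < π ^ 2 / q := by positivity
      nlinarith [Real.pi_pos]
    have := integrable_exp_mul_ghat hc
    convert this using 1; funext ξ; rw [norm_two_pi_smul_sq]; congr 2; ring
  have hintB : Integrable (fun ξ : E3 => (1 - cutoff ε ((2 * π) • ξ)) * ghat q ξ) := by
    have := (integrable_ghat hq).sub (integrable_cutoff_smul_mul_ghat hε.le hq)
    convert this using 1; funext ξ; simp only [Pi.sub_apply]; ring
  have hmono : ∫ ξ : E3, (Real.exp (-s * ‖(2 * π) • ξ‖ ^ 2) * ghat q ξ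
        - (1 - cutoff ε ((2 * π) • ξ)) * ghat q ξ)
      ≤ ∫ ξ : E3, (Real.exp (-s * ‖(2 * π) • ξ‖ ^ 2) * cutoff ε ((2 * π) • ξ)) * ghat q ξ := by
    refine integral_mono (hintA.sub hintB) (integrable_heat_mul_cutoff_smul_mul_ghat hε.le hs hq) ?_
    intro ξ
    have := heat_mul_cutoff_ge hε.le hs ((2 * π) • ξ)
    have hg := ghat_nonneg hq ξ
    nlinarith
  rw [integral_sub hintA hintB, hA] at hmono
  linarith

/-! ## Part C — numeric constants -/

/-- `2.718 < e`. -/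
lemma exp_one_gt : (2.718 : ℝ) < Real.exp 1 := lt_trans (by norm_num) Real.exp_one_gt_d9
/-- `e < 2.72`. -/
lemma exp_one_lt : Real.exp 1 < (2.72 : ℝ) := lt_trans Real.exp_one_lt_d9 (by norm_num)

/-- The two numeric facts the countermodels consume: `e^{-3} + 8e^{-9} ≤ 1/10` (Gaussian average of the
cutoff, parts 2/3) and `(e^{-3})² ≤ 1/400` (smallness of the instance `ν = 1`, `ε = e^{-2}`, `t = e^{-6}`),
both from `2.718 < e`. -/
lemma exp_neg_three_bounds :
    Real.exp (-3) + 8 * Real.exp (-9) ≤ 1 / 10 ∧ Real.exp (-3) ^ 2 ≤ 1 / 400 := by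
  have h20 : (20:ℝ) ≤ Real.exp 3 := by
    have h : Real.exp 3 = Real.exp 1 ^ 3 := by rw [← Real.exp_nat_mul]; norm_num
    rw [h]
    have h3 : (2.718:ℝ) ^ 3 < Real.exp 1 ^ 3 := pow_lt_pow_left₀ exp_one_gt (by norm_num) (by norm_num)
    have h20 : (20:ℝ) ≤ (2.718:ℝ) ^ 3 := by norm_num
    linarith
  have hA : Real.exp (-3) ≤ 1 / 20 := by
    rw [Real.exp_neg, ← one_div]
    exact one_div_le_one_div_of_le (by norm_num) h20
  have h0 : 0 ≤ Real.exp (-3) := (Real.exp_pos _).le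
  have h9 : Real.exp (-9) = Real.exp (-3) ^ 3 := by rw [← Real.exp_nat_mul]; norm_num
  have hB : Real.exp (-3) ^ 3 ≤ (1 / 20) ^ 3 := pow_le_pow_left₀ h0 hA 3
  have hC : Real.exp (-3) ^ 2 ≤ (1 / 20) ^ 2 := pow_le_pow_left₀ h0 hA 2
  constructor
  · rw [h9]; linarith [hB, show ((1:ℝ) / 20) ^ 3 = 1 / 8000 by norm_num]
  · linarith [hC, show ((1:ℝ) / 20) ^ 2 = 1 / 400 by norm_num]
end Summit.NavierStokesRegularity.NavierStokesRegularity.Theorems.Tsionskiy2025
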